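import Summits.HubbardSuperconductivity.HubbardSuperconductivity.Theorems.AnisotropyChordTransferFibre3N1RowExprJA

/-!
# Route `AnisotropyChord` / H0 rotor rung, LEVEL 2 row `N₁`: the `RExpr` transcription, part 4b — the object `B_C` at order `θ²`:
pair-block kernel and the brackets `J1lo`, `J1hi`

Blueprint: HOME/hubbard-h0-rotor-p2/level2_N1_hat_hybrid.py (§BC).  `Ĵ₁ := Ĵ/θ²`,
`Ĵ = θ⁶·Σ_e Σ_k [Re(φ̂_e(k)^*φ̂_e(k′))(F₂(k)+F₂(k′)) + |φ̂_e(k)|²F₂(k′)]`, `k′ = k + x̂` (`B_C = −3Ĵ/(4π²θ⁴)`).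
HYBRID kernel (as in part 3): every `φ̂_e(k)`, `k ≠ 0`, is its closed base part `μ̂_e(k) = −(1−z)β̂ + ½qq·t(1+z)`,
`z = e^{−iθ k·e}`, up to `P̂_e(k) = s_e|t̂(k)| + tτ̄/2`; `φ̂_e(0) = γ̂ = tγ₁` exactly.  At order `t`, with the unknowns
`w_n = (1 − cos nθ)/t` of part 3 (`n = k·e`, `n′ = k′·e = n + e₁`, `d = n − n′ = −e₁`):
`Re(μ̂₁^*μ̂₂)/t = (w_n + w_{n′} − w_d)β̂₁β̂₂ − ½qq·tβ̂₁(w_n − w_{n′} + w_d) − ½qq·tβ̂₂(w_{n′} − w_n + w_d) + ¼qq²t(4 − t(w_n + w_{n′} + w_d))`,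
the deviation `(|μ̂₁|P̂₂ + |μ̂₂|P̂₁ + P̂₁P̂₂)/t = √m2₁·p1₂ + √m2₂·p1₁ + p1₁p1₂`, and `|φ̂_e(k)|²/t ∈ [kerLo, kerHi]` (part 3).
Products with the sign-indefinite `F̂` factors use `min/max` of the two endpoint products.  The two special pairs `(0, x̂)` and
`(−x̂, 0)` carry `γ₁ = (νF̂(0) + 4a(a+η))/4`.  Outer closed part and the four tail majorants: part 4a (`J1o0Full/At`, `J1t·Full/At`).
★ `J1lo M₂`, `J1hi M₂`.  No soundness here (`…N1RowExprSound`).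
Prover seat `hubbard-h0-rotor-p2` g4; helper for piece A = stmt-HubbardSuperconductivity-23918 of rung 19089
(`--supports`, helper class).  Nothing here proves superconductivity in the Hubbard model; computable helper definitions of ONE
conditional reduction (the GM₃ ∀L certificate, Level-2 row `N₁`); the rotor TARGET as originally worded stays FALSE (g15 verdict).
Mathlib + the tree only; no sorry.
-/

set_option linter.dupNamespace false
set_option autoImplicit false

open Literature.Analysis.ValidatedNumerics

namespace Summit.HubbardSuperconductivity.HubbardSuperconductivity.Theorems.AnisotropyChord.Transfer.Fibre3.L2.N1

/-! ## The pair kernel at order `t` -/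

/-- `γ₁ = γ̂/t = (νF̂(0) + 4a(a+η))/4` (`φ̂_e(0) = γ̂`). -/
def gam1 : RExpr := .mul (.add (.mul vNu F0h) (.mul (.mul (cst 4) vA) (.add vA eta))) (cst (1/4))
/-- `x̂`-shift of a momentum. -/
def shx (q : ℤ × ℤ) : ℤ × ℤ := (q.1 + 1, q.2)
/-- `Re(μ̂_e(q)^* μ̂_e(q+x̂))/t` for `q, q + x̂ ≠ 0` (formula in the header). -/
def r12 (M : ℕ) (q e : ℤ × ℤ) : RExpr :=
  let wn := wOf M (qdot q e)
  let wn' := wOf M (qdot (shx q) e)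
  let wd := wOf M e.1
  let b1 := bh M q
  let b2 := bh M (shx q)
  rsum [ .mul (.sub (.add wn wn') wd) (.mul b1 b2),
    .neg (.mul (.mul (.mul (.mul (cst (1/2)) qq) vT) b1) (.add (.sub wn wn') wd)),
    .neg (.mul (.mul (.mul (.mul (cst (1/2)) qq) vT) b2) (.add (.sub wn' wn) wd)),
    .mul (.mul (.mul (cst (1/4)) (.sq qq)) vT) (.sub (cst 4) (.mul vT (.add (.add wn wn') wd))) ]
/-- the deviation `(|μ̂₁|P̂₂ + |μ̂₂|P̂₁ + P̂₁P̂₂)/t` for `q, q + x̂ ≠ 0`. -/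
def dev12 (M : ℕ) (q e : ℤ × ℤ) : RExpr :=
  rsum [ .mul (.sqrt (m2 M q e)) (p1 M (shx q) e), .mul (.sqrt (m2 M (shx q) e)) (p1 M q e), .mul (p1 M q e) (p1 M (shx q) e) ]
/-- lower/upper product of an interval `[lo, hi]` with a sign-indefinite factor `f`: `min(lo·f, hi·f)`. -/
def mulLo (lo hi f : RExpr) : RExpr := .min (.mul lo f) (.mul hi f)
/-- `max(lo·f, hi·f)`. -/
def mulHi (lo hi f : RExpr) : RExpr := .max (.mul lo f) (.mul hi f)
/-- lower pair term at a block pair `(q, q+x̂)`, both nonzero: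
`Σ_e [min((r12 ∓ dev)(F̂₁+F̂₂)) + min(ker·F̂₂)]`. -/
def pairLo (M : ℕ) (q : ℤ × ℤ) : RExpr :=
  let S := .add (Fh M q) (Fh M (shx q))
  rsum (E4.map fun e =>
    .add (mulLo (.sub (r12 M q e) (dev12 M q e)) (.add (r12 M q e) (dev12 M q e)) S)
         (mulLo (kerLo M q e) (kerHi M q e) (Fh M (shx q))))
/-- upper pair term at a block pair, both nonzero. -/
def pairHi (M : ℕ) (q : ℤ × ℤ) : RExpr :=
  let S := .add (Fh M q) (Fh M (shx q))
  rsum (E4.map fun e =>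
    .add (mulHi (.sub (r12 M q e) (dev12 M q e)) (.add (r12 M q e) (dev12 M q e)) S)
         (mulHi (kerLo M q e) (kerHi M q e) (Fh M (shx q))))
/-- `Re(γ̂ μ̂_e(k))/t = γ₁[−t·w_m β̂(k) + ½qq·t(2 − t·w_m)]`, `m = k·e`, for the special pairs (`k = x̂` or `−x̂`). -/
def r0 (M : ℕ) (k e : ℤ × ℤ) : RExpr :=
  let wm := wOf M (qdot k e)
  .mul gam1 (.add (.neg (.mul (.mul vT wm) (bh M k))) (.mul (.mul (.mul (cst (1/2)) qq) vT) (.sub (cst 2) (.mul vT wm))))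
/-- deviation at a special pair: `|γ̂|·P̂_e(k)/t = √t|γ₁|·p1(k)`. -/
def dev0 (M : ℕ) (k e : ℤ × ℤ) : RExpr := .mul (.mul (.sqrt vT) (.abs gam1)) (p1 M k e)
/-- the special pair `(0, x̂)`: `Σ_e [(r0 ∓ dev0)(F̂(0) + F̂(x̂)) + tγ₁²·F̂(x̂)]`, lower. -/
def pair0Lo (M : ℕ) : RExpr :=
  let k : ℤ × ℤ := (1, 0)
  let S := .add F0h (Fh M k)
  rsum (E4.map fun e =>
    .add (mulLo (.sub (r0 M k e) (dev0 M k e)) (.add (r0 M k e) (dev0 M k e)) S) (.mul (.mul vT (.sq gam1)) (Fh M k)))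
/-- the special pair `(0, x̂)`, upper. -/
def pair0Hi (M : ℕ) : RExpr :=
  let k : ℤ × ℤ := (1, 0)
  let S := .add F0h (Fh M k)
  rsum (E4.map fun e =>
    .add (mulHi (.sub (r0 M k e) (dev0 M k e)) (.add (r0 M k e) (dev0 M k e)) S) (.mul (.mul vT (.sq gam1)) (Fh M k)))
/-- the special pair `(−x̂, 0)`: `Σ_e [(r0 ∓ dev0)(F̂(−x̂) + F̂(0)) + ker(−x̂)·F̂(0)]`, lower. -/
def pairMLo (M : ℕ) : RExpr :=
  let k : ℤ × ℤ := (-1, 0)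
  let S := .add (Fh M k) F0h
  rsum (E4.map fun e =>
    .add (mulLo (.sub (r0 M k e) (dev0 M k e)) (.add (r0 M k e) (dev0 M k e)) S) (mulLo (kerLo M k e) (kerHi M k e) F0h))
/-- the special pair `(−x̂, 0)`, upper. -/
def pairMHi (M : ℕ) : RExpr :=
  let k : ℤ × ℤ := (-1, 0)
  let S := .add (Fh M k) F0h
  rsum (E4.map fun e =>
    .add (mulHi (.sub (r0 M k e) (dev0 M k e)) (.add (r0 M k e) (dev0 M k e)) S) (mulHi (kerLo M k e) (kerHi M k e) F0h))

/-! ## Outer parts and the brackets -/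

/-- the outer closed part `J1o0Full − Σ_{blockP} J1o0At`. -/
def J1outer (M2 : ℕ) : RExpr :=
  let M := M2 + 1
  .sub (J1o0Full M) (rsum ((blockP M2).map fun q => J1o0At M q))
/-- the clipped outer tails `Σ_{i ∈ {1,2,4,5}} max(J1tiFull − Σ_{blockP} J1tiAt, 0)`. -/
def J1tail (M2 : ℕ) : RExpr :=
  let M := M2 + 1
  rsum [ .max (.sub (J1t1Full M) (rsum ((blockP M2).map fun q => J1t1At M q))) (cst 0),
    .max (.sub (J1t2Full M) (rsum ((blockP M2).map fun q => J1t2At M q))) (cst 0),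
    .max (.sub (J1t4Full M) (rsum ((blockP M2).map fun q => J1t4At M q))) (cst 0),
    .max (.sub (J1t5Full M) (rsum ((blockP M2).map fun q => J1t5At M q))) (cst 0) ]
/-- ★ upper hatted bracket of `Ĵ₁ = Ĵ/θ²`. -/
def J1hi (M2 : ℕ) : RExpr :=
  let M := M2 + 1
  rsum [ pair0Hi M, pairMHi M, rsum ((blockP M2).map fun q => pairHi M q), J1outer M2, J1tail M2 ]
/-- ★ lower hatted bracket of `Ĵ₁ = Ĵ/θ²`. -/
def J1lo (M2 : ℕ) : RExpr :=
  let M := M2 + 1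
  rsum [ pair0Lo M, pairMLo M, rsum ((blockP M2).map fun q => pairLo M q), J1outer M2, .neg (J1tail M2) ]

end Summit.HubbardSuperconductivity.HubbardSuperconductivity.Theorems.AnisotropyChord.Transfer.Fibre3.L2.N1
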